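import Summits.KontsevichZagierPeriods.KontsevichZagierPeriods.Theorems.SoloBlindZetaBoxChart
import HarnessLib

/-!
# The tangent half-angle functions and the cyclic tangent chart, I: calculus

Beukers–Kolk–Calabi evaluate `∫∫ dx dy/(1 - x²y²)` by the trigonometric substitution
`x = sin u / cos v`, `y = sin v / cos u`.  Kontsevich–Zagier's rule (2) only allows ALGEBRAIC
changes of variables with rational-function data, so we run the substitution through the tangent
of the half angle: with `tᵢ = tan(θᵢ/2)`,

* `S(t) = 2t/(1+t²)`, `C(t) = (1-t²)/(1+t²)`, `W(t) = 2/(1+t²)` (`sin θ`, `cos θ`, `dθ/dt`), with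
  `S² + C² = 1`, `S' = C·W`, `C' = -S·W`, and the half-angle inversion `S/(1+C) = t`;
* the CYCLIC TANGENT CHART in dimension four, `Φ(t)ᵢ = S(tᵢ)/C(tᵢ₊₁)` (indices mod 4), on the
  `ℚ`-semialgebraic cell `T = {t | 0 < tᵢ, tᵢ + tᵢ₊₁ + tᵢtᵢ₊₁ < 1}` (i.e. `θᵢ + θᵢ₊₁ < π/2`);
* its derivative `DΦ(t)` (a cyclic bidiagonal matrix) and the Jacobian
  `det DΦ(t) = (1 - (∏ᵢ Φ(t)ᵢ)²) · ∏ᵢ W(tᵢ)`: the factor `1 - (x₀x₁x₂x₃)²` is exactly the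
  denominator of the even part of the `ζ(4)` box integrand, which the chart therefore flattens to
  the product measure `∏ W(tᵢ) dtᵢ = 16 dθ₀dθ₁dθ₂dθ₃`.

Part II (`SoloBlindTanChart`) proves that `Φ` is a bijection `T → (0,1)⁴` with an explicit
algebraic inverse, and packages the data of ONE move of rule (2).

References: F. Beukers, J. Kolk, E. Calabi, *Sums of generalized harmonic series and volumes*,
Nieuw Arch. Wisk. (4) 11 (1993) 217–224; N. Elkies, Amer. Math. Monthly 110 (2003) 561–573;
M. Kontsevich, D. Zagier, *Periods* (2001), §1.2.
-/

noncomputable section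

namespace Summit.KontsevichZagierPeriods.KontsevichZagierPeriods.Theorems

open Set MeasureTheory
open Literature.ModelTheory.ExponentialFields (IsSemialgebraic isSemialgebraic_setOf_eval_pos)
open MvPolynomial (aeval X C)
open Literature.NumberTheory.Transcendental
open Literature.NumberTheory.Transcendental.KZ

namespace SoloBlind

/-! ## The half-angle functions -/

/-- `S(t) = 2t/(1+t²)`, the sine of the double angle at `t = tan(θ/2)`. -/
def tS (u : ℝ) : ℝ := 2 * u / (1 + u ^ 2)

/-- `C(t) = (1-t²)/(1+t²)`, the cosine of the double angle. -/
def tC (u : ℝ) : ℝ := (1 - u ^ 2) / (1 + u ^ 2)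

/-- `W(t) = 2/(1+t²)`, the derivative of the double angle. -/
def tW (u : ℝ) : ℝ := 2 / (1 + u ^ 2)

/-- `S² + C² = 1`. -/
theorem tS_sq_add_tC_sq (u : ℝ) : tS u ^ 2 + tC u ^ 2 = 1 := by
  have h := (by positivity : (0 : ℝ) < 1 + u ^ 2).ne'
  unfold tS tC
  field_simp
  ring

/-- `1 - S² = C²`. -/
theorem one_sub_tS_sq (u : ℝ) : 1 - tS u ^ 2 = tC u ^ 2 := by
  linarith [tS_sq_add_tC_sq u]

/-- `S(t) > 0` for `t > 0`. -/
theorem tS_pos {u : ℝ} (hu : 0 < u) : 0 < tS u :=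
  div_pos (by positivity) (by positivity : (0 : ℝ) < 1 + u ^ 2)

/-- `S(t) ≥ 0` for `t ≥ 0`. -/
theorem tS_nonneg {u : ℝ} (hu : 0 ≤ u) : 0 ≤ tS u :=
  div_nonneg (by positivity) (by positivity : (0 : ℝ) < 1 + u ^ 2).le

/-- `C(t) > 0` for `0 ≤ t < 1`. -/
theorem tC_pos {u : ℝ} (h0 : 0 ≤ u) (h1 : u < 1) : 0 < tC u :=
  div_pos (by nlinarith) (by positivity : (0 : ℝ) < 1 + u ^ 2)

/-- `W(t) > 0`. -/
theorem tW_pos (u : ℝ) : 0 < tW u := div_pos two_pos (by positivity : (0 : ℝ) < 1 + u ^ 2)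

/-- `1 + C(t) = W(t)`. -/
theorem one_add_tC (u : ℝ) : 1 + tC u = tW u := by
  have h := (by positivity : (0 : ℝ) < 1 + u ^ 2).ne'
  unfold tC tW
  field_simp
  ring

/-- **Half-angle inversion**: `S(t)/(1 + C(t)) = t`. -/
theorem tS_div_one_add_tC (u : ℝ) : tS u / (1 + tC u) = u := by
  have h := (by positivity : (0 : ℝ) < 1 + u ^ 2).ne'
  rw [one_add_tC]
  unfold tS tW
  rw [div_div_div_cancel_right₀ h]
  ring

/-- **Half-angle parametrisation**: for `s² + c² = 1`, `c > -1`, the point `t = s/(1+c)` has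
`S(t) = s` and `C(t) = c`. -/
theorem tS_tC_half_angle {s c : ℝ} (hc : 0 < 1 + c) (h : s ^ 2 + c ^ 2 = 1) :
    tS (s / (1 + c)) = s ∧ tC (s / (1 + c)) = c := by
  have hc' : 1 + c ≠ 0 := hc.ne'
  have h1 : 1 + (s / (1 + c)) ^ 2 = 2 / (1 + c) := by
    rw [div_pow, one_add_div (pow_ne_zero 2 hc'),
      show (1 + c) ^ 2 + s ^ 2 = 2 * (1 + c) by linear_combination h, pow_two,
      mul_div_mul_right _ _ hc']
  have h2 : 1 - (s / (1 + c)) ^ 2 = 2 * c / (1 + c) := by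
    rw [div_pow, one_sub_div (pow_ne_zero 2 hc'),
      show (1 + c) ^ 2 - s ^ 2 = 2 * c * (1 + c) by linear_combination -h, pow_two,
      mul_div_mul_right _ _ hc']
  unfold tS tC
  rw [h1, h2]
  constructor
  · rw [mul_div_assoc', div_div_div_cancel_right₀ hc']
    ring
  · rw [div_div_div_cancel_right₀ hc']
    ring

/-- `S' = C · W`. -/
theorem hasDerivAt_tS (u : ℝ) : HasDerivAt tS (tC u * tW u) u := by
  have h := (by positivity : (0 : ℝ) < 1 + u ^ 2).ne'
  have hnum : HasDerivAt (fun y : ℝ => 2 * y) (2 * 1) u := (hasDerivAt_id u).const_mul 2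
  have hden : HasDerivAt (fun y : ℝ => 1 + y ^ 2) (0 + (2 : ℕ) * u ^ (2 - 1)) u :=
    (hasDerivAt_const u 1).add (hasDerivAt_pow 2 u)
  refine ((hnum.div hden h).congr_deriv ?_).congr_of_eventuallyEq (by rfl)
  unfold tC tW
  field_simp
  push_cast
  ring

/-- `C' = -S · W`. -/
theorem hasDerivAt_tC (u : ℝ) : HasDerivAt tC (-(tS u * tW u)) u := by
  have h := (by positivity : (0 : ℝ) < 1 + u ^ 2).ne'
  have hnum : HasDerivAt (fun y : ℝ => 1 - y ^ 2) (0 - (2 : ℕ) * u ^ (2 - 1)) u :=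
    (hasDerivAt_const u 1).sub (hasDerivAt_pow 2 u)
  have hden : HasDerivAt (fun y : ℝ => 1 + y ^ 2) (0 + (2 : ℕ) * u ^ (2 - 1)) u :=
    (hasDerivAt_const u 1).add (hasDerivAt_pow 2 u)
  refine ((hnum.div hden h).congr_deriv ?_).congr_of_eventuallyEq (by rfl)
  unfold tS tW
  field_simp
  push_cast
  ring

/-- `(1/C)' = S · W / C²` where `C ≠ 0`. -/
theorem hasDerivAt_inv_tC {u : ℝ} (hu : tC u ≠ 0) :
    HasDerivAt (fun y => (tC y)⁻¹) (tS u * tW u / tC u ^ 2) u := by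
  refine ((hasDerivAt_tC u).inv hu).congr_deriv ?_
  ring

/-- **The addition law**: for `0 ≤ u < 1` and `0 ≤ v`, `S(u) < C(v) ↔ u + v + uv < 1`
(`sin 2α < cos 2β ↔ 2α + 2β < π/2`; algebraically,
`(1-v²)(1+u²) - 2u(1+v²) = ((1-u) - v(1+u))·((1-u) + v(1+u))`). -/
theorem tS_lt_tC_iff {u v : ℝ} (hu0 : 0 ≤ u) (hu1 : u < 1) (hv : 0 ≤ v) :
    tS u < tC v ↔ u + v + u * v < 1 := by
  unfold tS tC
  rw [div_lt_div_iff₀ (by positivity : (0 : ℝ) < 1 + u ^ 2) (by positivity : (0 : ℝ) < 1 + v ^ 2)]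
  have iden : (1 - v ^ 2) * (1 + u ^ 2) - 2 * u * (1 + v ^ 2) =
      ((1 - u) - v * (1 + u)) * ((1 - u) + v * (1 + u)) := by ring
  have hpos : 0 < (1 - u) + v * (1 + u) := by nlinarith
  constructor
  · intro hlt
    have h1 : 0 < ((1 - u) - v * (1 + u)) * ((1 - u) + v * (1 + u)) := by
      rw [← iden]; linarith
    have h2 := (mul_pos_iff_of_pos_right hpos).mp h1
    nlinarith
  · intro hlt
    have h1 : 0 < ((1 - u) - v * (1 + u)) * ((1 - u) + v * (1 + u)) :=
      mul_pos (by nlinarith) hpos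
    rw [← iden] at h1
    linarith

/-! ## The cyclic tangent cell and chart in dimension four -/

/-- The cyclic tangent cell `T = {t ∈ ℝ⁴ | 0 < tᵢ, tᵢ + tᵢ₊₁ + tᵢtᵢ₊₁ < 1 (i mod 4)}`. -/
def tanCell : Set (Fin 4 → ℝ) := {t | ∀ i, 0 < t i ∧ t i + t (i + 1) + t i * t (i + 1) < 1}

/-- Membership in the tangent cell. -/
theorem mem_tanCell {t : Fin 4 → ℝ} :
    t ∈ tanCell ↔ ∀ i, 0 < t i ∧ t i + t (i + 1) + t i * t (i + 1) < 1 := Iff.rfl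

/-- On the cell every coordinate is `< 1`. -/
theorem lt_one_of_mem_tanCell {t : Fin 4 → ℝ} (ht : t ∈ tanCell) (i : Fin 4) : t i < 1 := by
  obtain ⟨h0, h1⟩ := ht (i + 3)
  have e : i + 3 + 1 = i := by
    rw [add_assoc]
    exact add_eq_left.mpr (by decide)
  rw [e] at h1
  nlinarith [(ht i).1]

/-- On the cell `C(tᵢ) > 0`. -/
theorem tC_pos_of_mem_tanCell {t : Fin 4 → ℝ} (ht : t ∈ tanCell) (i : Fin 4) : 0 < tC (t i) :=
  tC_pos (ht i).1.le (lt_one_of_mem_tanCell ht i)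

/-- The tangent cell is `ℚ`-semialgebraic. -/
theorem isSemialgebraic_tanCell : IsSemialgebraic ℚ tanCell := by
  have h : tanCell = ⋂ i ∈ (Finset.univ : Finset (Fin 4)),
      ({t : Fin 4 → ℝ | 0 < aeval t (X i : MvPolynomial (Fin 4) ℚ)} ∩
        {t | 0 < aeval t (1 - X i - X (i + 1) - X i * X (i + 1) : MvPolynomial (Fin 4) ℚ)}) := by
    ext t
    simp only [mem_tanCell, Finset.mem_univ, iInter_true, mem_iInter, mem_inter_iff,
      mem_setOf_eq, map_sub, map_mul, map_one, MvPolynomial.aeval_X]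
    refine forall_congr' fun i => and_congr Iff.rfl ?_
    constructor <;> intro h <;> linarith
  rw [h]
  exact IsSemialgebraic.biInter _ _ fun i _ =>
    (isSemialgebraic_setOf_eval_pos _).inter (isSemialgebraic_setOf_eval_pos _)

/-- The tangent cell is measurable. -/
theorem measurableSet_tanCell : MeasurableSet tanCell :=
  IsSemialgebraic.measurableSet_holds isSemialgebraic_tanCell

/-- The tangent cell lies in the open unit box. -/
theorem tanCell_subset_kzOpenBox : tanCell ⊆ kzOpenBox 4 := fun _ ht i =>
  ⟨(ht i).1, lt_one_of_mem_tanCell ht i⟩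

/-- **The cyclic tangent chart** `Φ(t)ᵢ = S(tᵢ)/C(tᵢ₊₁)`. -/
def tanChart (t : Fin 4 → ℝ) : Fin 4 → ℝ := fun i => tS (t i) / tC (t (i + 1))

/-- Coordinates of the chart. -/
@[simp] theorem tanChart_apply (t : Fin 4 → ℝ) (i : Fin 4) :
    tanChart t i = tS (t i) / tC (t (i + 1)) := rfl

/-- The chart maps the cell into the open box: `0 < S(tᵢ)/C(tᵢ₊₁) < 1` by the addition law. -/
theorem tanChart_mem {t : Fin 4 → ℝ} (ht : t ∈ tanCell) : tanChart t ∈ kzOpenBox 4 := by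
  intro i
  have hC := tC_pos_of_mem_tanCell ht (i + 1)
  refine ⟨div_pos (tS_pos (ht i).1) hC, (div_lt_one hC).mpr ?_⟩
  exact (tS_lt_tC_iff (ht i).1.le (lt_one_of_mem_tanCell ht i) (ht (i + 1)).1.le).mpr (ht i).2

/-- The defining relation of the chart: `Φ(t)ᵢ² · (1 - S(tᵢ₊₁)²) = S(tᵢ)²`. -/
theorem tanChart_sq_mul {t : Fin 4 → ℝ} (ht : t ∈ tanCell) (i : Fin 4) :
    tanChart t i ^ 2 * (1 - tS (t (i + 1)) ^ 2) = tS (t i) ^ 2 := by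
  rw [tanChart_apply, one_sub_tS_sq, div_pow,
    div_mul_cancel₀ _ (pow_ne_zero 2 (tC_pos_of_mem_tanCell ht (i + 1)).ne')]

/-! ## The derivative and its determinant -/

/-- Diagonal entries of `DΦ`: `∂Φᵢ/∂tᵢ = C(tᵢ)W(tᵢ)/C(tᵢ₊₁)`. -/
def tanDiag (t : Fin 4 → ℝ) (i : Fin 4) : ℝ := tC (t i) * tW (t i) / tC (t (i + 1))

/-- Cyclic superdiagonal entries of `DΦ`: `∂Φᵢ/∂tᵢ₊₁ = S(tᵢ)S(tᵢ₊₁)W(tᵢ₊₁)/C(tᵢ₊₁)²`. -/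
def tanSuper (t : Fin 4 → ℝ) (i : Fin 4) : ℝ :=
  tS (t i) * (tS (t (i + 1)) * tW (t (i + 1)) / tC (t (i + 1)) ^ 2)

/-- The derivative `DΦ(t)`: row `i` is `tanDiag t i · dtᵢ + tanSuper t i · dtᵢ₊₁`. -/
def tanDeriv (t : Fin 4 → ℝ) : (Fin 4 → ℝ) →L[ℝ] (Fin 4 → ℝ) :=
  ContinuousLinearMap.pi fun i : Fin 4 =>
    tanDiag t i • ContinuousLinearMap.proj (R := ℝ) (φ := fun _ : Fin 4 => ℝ) i +
      tanSuper t i • ContinuousLinearMap.proj (R := ℝ) (φ := fun _ : Fin 4 => ℝ) (i + 1)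

/-- The derivative applied to a vector. -/
theorem tanDeriv_apply (t v : Fin 4 → ℝ) (i : Fin 4) :
    tanDeriv t v i = tanDiag t i * v i + tanSuper t i * v (i + 1) := by
  simp [tanDeriv]

/-- The chart is differentiable on the cell with derivative `tanDeriv`. -/
theorem hasFDerivAt_tanChart {t : Fin 4 → ℝ} (ht : t ∈ tanCell) :
    HasFDerivAt tanChart (tanDeriv t) t := by
  change HasFDerivAt (fun t i => tS (t i) / tC (t (i + 1)))
    (ContinuousLinearMap.pi fun i : Fin 4 =>
      tanDiag t i • ContinuousLinearMap.proj (R := ℝ) (φ := fun _ : Fin 4 => ℝ) i +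
        tanSuper t i • ContinuousLinearMap.proj (R := ℝ) (φ := fun _ : Fin 4 => ℝ) (i + 1)) t
  rw [hasFDerivAt_pi]
  intro i
  have hC : tC (t (i + 1)) ≠ 0 := (tC_pos_of_mem_tanCell ht (i + 1)).ne'
  have h1 : HasFDerivAt (fun y : Fin 4 → ℝ => tS (y i))
      ((tC (t i) * tW (t i)) • ContinuousLinearMap.proj (R := ℝ) (φ := fun _ : Fin 4 => ℝ) i)
      t :=
    HasDerivAt.comp_hasFDerivAt (h₂ := tS) (f := fun y : Fin 4 → ℝ => y i) t
      (hasDerivAt_tS (t i)) (hasFDerivAt_apply i t)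
  have h2 : HasFDerivAt (fun y : Fin 4 → ℝ => (tC (y (i + 1)))⁻¹)
      ((tS (t (i + 1)) * tW (t (i + 1)) / tC (t (i + 1)) ^ 2) •
        ContinuousLinearMap.proj (R := ℝ) (φ := fun _ : Fin 4 => ℝ) (i + 1)) t :=
    HasDerivAt.comp_hasFDerivAt (h₂ := fun y => (tC y)⁻¹) (f := fun y : Fin 4 → ℝ => y (i + 1))
      t (hasDerivAt_inv_tC hC) (hasFDerivAt_apply (i + 1) t)
  have hf : (fun y : Fin 4 → ℝ => tS (y i) / tC (y (i + 1))) =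
      fun y => tS (y i) * (tC (y (i + 1)))⁻¹ := funext fun y => div_eq_mul_inv _ _
  rw [hf]
  refine (h1.mul h2).congr_fderiv (ContinuousLinearMap.ext fun v => ?_)
  simp [tanDiag, tanSuper]
  field_simp
  ring

/-- **The determinant of a cyclic bidiagonal `4 × 4` matrix.** -/
theorem det_cyclicBidiag (a₀ a₁ a₂ a₃ b₀ b₁ b₂ b₃ : ℝ) :
    !![a₀, b₀, 0, 0; 0, a₁, b₁, 0; 0, 0, a₂, b₂; b₃, 0, 0, a₃].det =
      a₀ * a₁ * a₂ * a₃ - b₀ * b₁ * b₂ * b₃ := by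
  have e12 : Fin.succAbove (1 : Fin 4) (2 : Fin 3) = 3 := by decide
  have e22 : Fin.succAbove (2 : Fin 4) (2 : Fin 3) = 3 := by decide
  rw [Matrix.det_succ_row_zero]
  simp [Fin.sum_univ_succ, Matrix.det_fin_three, Fin.succ_zero_eq_one, Fin.succ_one_eq_two,
    e12, e22]
  ring

/-- The matrix of `DΦ(t)` is cyclic bidiagonal. -/
theorem toMatrix_tanDeriv (t : Fin 4 → ℝ) :
    LinearMap.toMatrix' ((tanDeriv t : (Fin 4 → ℝ) →L[ℝ] (Fin 4 → ℝ)) :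
      (Fin 4 → ℝ) →ₗ[ℝ] (Fin 4 → ℝ)) =
      !![tanDiag t 0, tanSuper t 0, 0, 0; 0, tanDiag t 1, tanSuper t 1, 0;
        0, 0, tanDiag t 2, tanSuper t 2; tanSuper t 3, 0, 0, tanDiag t 3] := by
  ext i j
  rw [LinearMap.toMatrix'_apply, ContinuousLinearMap.coe_coe, tanDeriv_apply]
  fin_cases i <;> fin_cases j <;> simp

/-- `∏ᵢ Φ(t)ᵢ`, unfolded. -/
theorem prod_tanChart (t : Fin 4 → ℝ) :
    ∏ i, tanChart t i = tS (t 0) * tS (t 1) * tS (t 2) * tS (t 3) /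
      (tC (t 0) * tC (t 1) * tC (t 2) * tC (t 3)) := by
  rw [Fin.prod_univ_four]
  simp only [tanChart_apply, Fin.reduceAdd]
  ring

/-- **The Jacobian**: `det DΦ(t) = (1 - (∏ᵢ Φ(t)ᵢ)²) · ∏ᵢ W(tᵢ)` wherever all `C(tᵢ) ≠ 0`. -/
theorem det_tanDeriv {t : Fin 4 → ℝ} (hC : ∀ i, tC (t i) ≠ 0) :
    (tanDeriv t).det = (1 - (∏ i, tanChart t i) ^ 2) * ∏ i, tW (t i) := by
  rw [ContinuousLinearMap.det, ← LinearMap.det_toMatrix', toMatrix_tanDeriv, det_cyclicBidiag,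
    prod_tanChart, Fin.prod_univ_four]
  simp only [tanDiag, tanSuper, Fin.reduceAdd]
  have h0 := hC 0; have h1 := hC 1; have h2 := hC 2; have h3 := hC 3
  field_simp

/-- On the cell the Jacobian is positive, and `|det DΦ| = (1 - (∏Φᵢ)²)·∏W(tᵢ)`. -/
theorem abs_det_tanDeriv {t : Fin 4 → ℝ} (ht : t ∈ tanCell) :
    |(tanDeriv t).det| = (1 - (∏ i, tanChart t i) ^ 2) * ∏ i, tW (t i) := by
  rw [det_tanDeriv fun i => (tC_pos_of_mem_tanCell ht i).ne']
  refine abs_of_pos (mul_pos ?_ (Finset.prod_pos fun i _ => tW_pos (t i)))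
  have hP := BoxIntegral.prod_mem_Ioo (by norm_num) (tanChart_mem ht)
  nlinarith [hP.1, hP.2]

end SoloBlind

end Summit.KontsevichZagierPeriods.KontsevichZagierPeriods.Theorems
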